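import Mathlib
import Summits.Ventures.PercRepro2.PMK5LocusFace
import Summits.Ventures.PercRepro2.PMK5LocusZero
import Summits.Ventures.PercRepro2.PMK5LocusSSb

/-!
# THE EQUALITY LOCUS OF THE `a₂`-SIDE SAME-SIDE SLACK `SS′` ON FIVE-VERTEX BASES — THE ZERO SIDE AND THE TWO «IFF»s
(blind cell PercRepro2, mine-2 g24; the mirror of `PMK5LocusZeroSS.lean`; on `PMK5LocusSSb.lean` (the certificate,
the bridge, the positive side, `RuleSSb`) and the restricted-table machinery of `PMK5LocusFace.lean`)

The `SS′`-degenerate edge sets form a down-set with FOUR maximal elements `MxSSb = {249, 503, 637, 1011}`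
(`K₅ − {oa₂, ou, a₂b, ub}`, `K₅ − {ob, ub}`, `K₅ − {oa₂, a₂u, a₂b}`, `K₅ − {ou, ob}`; `coverZSSb`); the restricted
Kronecker numbers agree on each (`faceSSb_*`, four `decide +kernel`), so every coefficient supported inside a
degenerate face vanishes (`coefSSb_eq_of_face`), whence **`ssb_K5_zero_of_face`** and the «iff»s
**`ssb_K5_pos_iff`** / **`ssb_K5_zero_iff`**.  Standard axioms.
-/

namespace Summit.Ventures.PercRepro2

open Hub CovForm

namespace K5

namespace PM

/-- The positive part of `SS′` on the face `m`. -/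
def kPosSSbm (m : ℕ) : ℕ := kp (restr m tQ) (restr m tQHoBH) (restr m tOne)
/-- The negative part of `SS′` on the face `m`. -/
def kNegSSbm (m : ℕ) : ℕ := kp (restr m tQHo) (restr m tQB) (restr m tOne)
/-- The positive triple counts of `SS′` on the face `m`. -/
def cntPosSSbm (m : ℕ) (k : Fin 10 → Fin 4) : ℕ := cnt3 (restr m tQ) (restr m tQHoBH) (restr m tOne) k
/-- The negative triple counts of `SS′` on the face `m`. -/
def cntNegSSbm (m : ℕ) (k : Fin 10 → Fin 4) : ℕ := cnt3 (restr m tQHo) (restr m tQB) (restr m tOne) k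

/-- `kPosSSbm` carries the restricted positive counts. -/
lemma kPosSSbm_eq (m : ℕ) : kPosSSbm m = ∑ k, cntPosSSbm m k * KB ^ idx4 k := by
  unfold kPosSSbm cntPosSSbm; rw [kp_eq]
/-- `kNegSSbm` carries the restricted negative counts. -/
lemma kNegSSbm_eq (m : ℕ) : kNegSSbm m = ∑ k, cntNegSSbm m k * KB ^ idx4 k := by
  unfold kNegSSbm cntNegSSbm; rw [kp_eq]
/-- The restricted positive counts are below `2^19`. -/
lemma cntPosSSbm_lt (m : ℕ) (k : Fin 10 → Fin 4) : cntPosSSbm m k < 2 ^ 19 := by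
  unfold cntPosSSbm
  have := cnt3_le (restr m tQ) (restr m tQHoBH) (restr m tOne) k
  omega
/-- The restricted negative counts are below `2^19`. -/
lemma cntNegSSbm_lt (m : ℕ) (k : Fin 10 → Fin 4) : cntNegSSbm m k < 2 ^ 19 := by
  unfold cntNegSSbm
  have := cnt3_le (restr m tQHo) (restr m tQB) (restr m tOne) k
  omega

/-! ## The four maximal `SS′`-degenerate faces (kernel) -/

set_option maxRecDepth 100000 in
/-- The restricted numbers of `SS′` agree on the face `249` = {oa1 ob a1a2 a1u a1b a2u}. -/
theorem faceSSb_249 : kPosSSbm 249 = kNegSSbm 249 := by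
  decide +kernel

set_option maxRecDepth 100000 in
/-- The restricted numbers of `SS′` agree on the face `503` = {oa1 oa2 ou a1a2 a1u a1b a2u a2b}. -/
theorem faceSSb_503 : kPosSSbm 503 = kNegSSbm 503 := by
  decide +kernel

set_option maxRecDepth 100000 in
/-- The restricted numbers of `SS′` agree on the face `637` = {oa1 ou ob a1a2 a1u a1b ub}. -/
theorem faceSSb_637 : kPosSSbm 637 = kNegSSbm 637 := by
  decide +kernel

set_option maxRecDepth 100000 in
/-- The restricted numbers of `SS′` agree on the face `1011` = {oa1 oa2 a1a2 a1u a1b a2u a2b ub}. -/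
theorem faceSSb_1011 : kPosSSbm 1011 = kNegSSbm 1011 := by
  decide +kernel

/-- **Every coefficient of `SS′` supported inside a face with equal restricted numbers vanishes.** -/
theorem coefSSb_eq_of_face (m : ℕ) (hz : kPosSSbm m = kNegSSbm m) (k : Fin 10 → Fin 4)
    (hk : ∀ e : Fin 10, k e ≠ 0 → m.testBit e = true) : cntPosSSb k = cntNegSSb k := by
  have h := eq_of_kron_eq _ _ (cntPosSSbm_lt m) (cntNegSSbm_lt m) (kPosSSbm_eq m) (kNegSSbm_eq m) hz k
  unfold cntPosSSbm cntNegSSbm at h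
  simp only [cnt3_restr_eq hk] at h
  unfold cntPosSSb cntNegSSb
  omega

/-- The four maximal `SS′`-degenerate edge sets. -/
def MxSSb : Fin 4 → ℕ := ![249, 503, 637, 1011]

set_option maxRecDepth 100000 in
/-- **Every `SS′`-degenerate edge set lies inside one of the four maximal ones.** -/
theorem coverZSSb : ∀ m : Fin 1024, RuleSSb m = true →
    ∃ i : Fin 4, ∀ e : Fin 10, (m : ℕ).testBit e = true → (MxSSb i).testBit e = true := by
  decide +kernel

/-- The restricted numbers agree on each maximal `SS′`-degenerate face. -/
theorem faceSSb_all : ∀ i : Fin 4, kPosSSbm (MxSSb i) = kNegSSbm (MxSSb i) := by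
  intro i
  fin_cases i
  exacts [faceSSb_249, faceSSb_503, faceSSb_637, faceSSb_1011]

section Face

variable {R : Type*} [Field R] [LinearOrder R] [IsStrictOrderedRing R]

omit [LinearOrder R] [IsStrictOrderedRing R] in
/-- **THE EQUALITY LOCUS OF THE SAME-SIDE SLACK — THE ZERO SIDE (Bernstein form).** -/
theorem ssb_K5_zero_of_face (m : ℕ) (hm : m < 1024) (hr : RuleSSb m = true) (q : Fin 10 → R)
    (hq₀ : ∀ e : Fin 10, m.testBit e = false → q e = 0) :
    ∑ k, bern q k * ((cntPosSSb k : ℕ) - (cntNegSSb k : ℕ) : R) = 0 := by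
  refine Finset.sum_eq_zero fun k _ => ?_
  by_cases hk : ∀ e : Fin 10, k e ≠ 0 → m.testBit e = true
  · obtain ⟨i, hi⟩ := coverZSSb ⟨m, hm⟩ hr
    have hc := coefSSb_eq_of_face (MxSSb i) (faceSSb_all i) k fun e he => hi e (hk e he)
    rw [hc, sub_self, mul_zero]
  · obtain ⟨e, he⟩ := not_forall.1 hk
    obtain ⟨hke, hme⟩ := Classical.not_imp.1 he
    have hqe : q e = 0 := hq₀ e (by simpa using hme)
    have hb : bern q k = 0 := by
      unfold bern
      apply Finset.prod_eq_zero (Finset.mem_univ e)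
      rw [hqe, zero_pow (fun h => hke (Fin.ext (by simpa using h)))]
      simp
    rw [hb, zero_mul]

/-- **THE EQUALITY LOCUS OF `SS′`, FIRST «IFF»**: `SS > 0` at every weight vector interior on `m` ⟺ `m` is not
`SS′`-degenerate. -/
theorem ssb_K5_pos_iff (m : ℕ) (hm : m < 1024) :
    (∀ q : Fin 10 → R, (∀ e : Fin 10, m.testBit e = true → 0 < q e ∧ q e < 1) →
      (∀ e : Fin 10, m.testBit e = false → q e = 0) →
      0 < ∑ k, bern q k * ((cntPosSSb k : ℕ) - (cntNegSSb k : ℕ) : R)) ↔ RuleSSb m = false := by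
  constructor
  · intro h
    rcases Bool.eq_false_or_eq_true (RuleSSb m) with hr | hr
    · exfalso
      have hpos := h (centre (R := R) m) (fun e he => centre_on_pos he) (fun e he => centre_off he)
      have hzero := ssb_K5_zero_of_face m hm hr (centre (R := R) m) (fun e he => centre_off he)
      rw [hzero] at hpos
      exact lt_irrefl _ hpos
    · exact hr
  · intro hr q hq₁ hq₀
    exact ssb_K5_pos_of_face m hm hr q hq₁ hq₀

/-- **THE EQUALITY LOCUS OF `SS′`, SECOND «IFF»**: `SS = 0` at every admissible weight vector supported on `m` ⟺ `m`
is `SS′`-degenerate. -/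
theorem ssb_K5_zero_iff (m : ℕ) (hm : m < 1024) :
    (∀ q : Fin 10 → R, (∀ e : Fin 10, 0 ≤ q e ∧ q e ≤ 1) →
      (∀ e : Fin 10, m.testBit e = false → q e = 0) →
      ∑ k, bern q k * ((cntPosSSb k : ℕ) - (cntNegSSb k : ℕ) : R) = 0) ↔ RuleSSb m = true := by
  constructor
  · intro h
    rcases Bool.eq_false_or_eq_true (RuleSSb m) with hr | hr
    · exact hr
    · exfalso
      have hpos := ssb_K5_pos_of_face m hm hr (centre (R := R) m)
        (fun e he => centre_on_pos he) (fun e he => centre_off he)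
      have hzero := h (centre (R := R) m) (centre_01 m) (fun e he => centre_off he)
      rw [hzero] at hpos
      exact lt_irrefl _ hpos
  · intro hr q _ hq₀
    exact ssb_K5_zero_of_face m hm hr q hq₀

end Face

end PM

end K5

end Summit.Ventures.PercRepro2
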